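import Summits.QuantumFields.YangMills.Theses.OnsetTautology

/-!
# Assembly of route `OnsetTautology` (planner seat ym-idea-11 g6; route status draft at the time of writing)

The route file's kernel-checked deciding theorem `closes` packaged as the proof of the route's `Assembly` item (stmt-QuantumFields-28184):
the recorded implication from the route's items to `InfiniteVolumeContinuum.HypercubicOSDataFromInfiniteVolume` (a crux decl of another route, not the summit Statement).  No summit, no rung and no crux is proved here; every crux of the route
stays open.  Width seat ym-line-sfw-p2-w2 g20 (cell `ym-idea-1`, free hands).
-/

namespace Summit.QuantumFields.YangMills.Theorems

open Summit.QuantumFields.YangMills.Theses.OnsetTautology in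
/-- The `Assembly` item of route `OnsetTautology` holds: it is the route's deciding theorem `closes` read as an implication. [folklore] -/
theorem onsetTautology_assembly : Summit.QuantumFields.YangMills.Theses.OnsetTautology.Assembly :=
  fun hA hB hR hC hCal => closes hA hB hR hC hCal

end Summit.QuantumFields.YangMills.Theorems
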